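import Summits.ValiantsHypothesis.ValiantsHypothesis.Theses.PolyaContinued
import Summits.ValiantsHypothesis.ValiantsHypothesis.Theorems.HubHub

/-!
# Route PolyaContinued — item `Assembly`

Item `stmt-ValiantsHypothesis-7427` (assembly of route `PolyaContinued`): pure bookkeeping.
`Assembly := PfaffianCoverHard → PfaffianNormalForm → ValiantsHypothesis`: if the permanent of
`K_{n,n}` over `ℂ` has no quasi-polynomial Pfaffian cover (`PfaffianCoverHard`, the route target)
and every affine determinantal representation converts into a Pfaffian cover of quasi-polynomial
size uniformly in the number of variables (`PfaffianNormalForm`), then `VP ℂ ≠ VNP ℂ`.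

Proof (no unproved named fact enters): were the permanent a `VP` family, `n ↦ dc(per_n)` would be
quasi-polynomially bounded, `dc(per_n) ≤ 2^((log₂ n + c₁)^c₁)`
(`Literature.Computability.AlgebraicComplexity.isQPBounded_determinantalComplexity_of_isVPFamily_holds`,
Bürgisser–Clausen–Shokrollahi 1997 Cor. (21.40), proved in tree) and attained
(`hasDetRepr_determinantalComplexity_holds`); `PfaffianNormalForm` with constant `c` turns the
size-`dc(per_n)` representation in `n²` variables into a Pfaffian cover of size
`≤ 2^((log₂(dc(per_n) + n²) + c)^c) ≤ 2^((log₂ n + K)^K)` with `K = c₁ + c + 3 + (c₁ + 3)c`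
(lemma `assembly_exponent_le`, elementary `Nat.log` arithmetic), contradicting
`PfaffianCoverHard`; the landed hub lemma
`Summit.ValiantsHypothesis.Hub.valiantsHypothesis_of_not_isVPFamily_per` (Theorems/HubHub.lean)
turns "per is not a `VP` family", the renaming bridge `mem_VP_ofFintype_iff_holds` and Valiant's
`perFamily_mem_VNP_holds` into `VP ℂ ≠ VNP ℂ`. The argument is the one of the route's deciding
theorem `Theses.PolyaContinued.closes`; it is redone here (rather than invoked) so that this file
does not depend on the planner-editable deciding theorem.
-/

-- `Summit.ValiantsHypothesis.ValiantsHypothesis.…` is the tree's mandated single-conjunct layout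
-- (Sub = Summit), so the duplicated namespace component is intended.
set_option linter.dupNamespace false

namespace Summit.ValiantsHypothesis.ValiantsHypothesis.Theorems.PolyaContinued

open Literature.Computability.AlgebraicComplexity

/-- Exponent bookkeeping for the PolyaContinued assembly: if `d ≤ 2^((L + c₁)^c₁)` and
`k ≤ 2^(2L + 2)` then `(Nat.log 2 (d + k) + c)^c ≤ (L + K)^K` with `K = c₁ + c + 3 + (c₁ + 3)c`.
(Used with `L = log₂ n`, `d = dc(per_n)`, `k = n²`.) [folklore] -/
theorem assembly_exponent_le (L c₁ c d k : ℕ) (hd : d ≤ 2 ^ ((L + c₁) ^ c₁))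
    (hk : k ≤ 2 ^ (2 * L + 2)) :
    (Nat.log 2 (d + k) + c) ^ c ≤
      (L + (c₁ + c + 3 + (c₁ + 3) * c)) ^ (c₁ + c + 3 + (c₁ + 3) * c) := by
  set A := (L + c₁) ^ c₁ with hA
  have hsum : d + k ≤ 2 ^ (A + 2 * L + 3) := by
    calc d + k ≤ 2 ^ A + 2 ^ (2 * L + 2) := Nat.add_le_add hd hk
      _ ≤ 2 ^ (A + 2 * L + 2) + 2 ^ (A + 2 * L + 2) :=
          Nat.add_le_add (Nat.pow_le_pow_right Nat.two_pos (by omega))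
            (Nat.pow_le_pow_right Nat.two_pos (by omega))
      _ = 2 ^ (A + 2 * L + 3) := by rw [← two_mul, ← pow_succ']
  have hlog : Nat.log 2 (d + k) ≤ A + 2 * L + 3 := by
    calc Nat.log 2 (d + k) ≤ Nat.log 2 (2 ^ (A + 2 * L + 3)) := Nat.log_mono_right hsum
      _ = A + 2 * L + 3 := Nat.log_pow Nat.one_lt_two _
  -- D = L + (c₁ + c + 3) ≥ 3 absorbs everything: A ≤ D^(c₁+1), 2L + 3 + c ≤ D²
  set D := L + (c₁ + c + 3) with hD
  have hD2 : 2 ≤ D := by omega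
  have hAD : A ≤ D ^ (c₁ + 1) := by
    calc A = (L + c₁) ^ c₁ := hA
      _ ≤ D ^ c₁ := Nat.pow_le_pow_left (by omega) c₁
      _ ≤ D ^ c₁ * D := Nat.le_mul_of_pos_right _ (by omega)
      _ = D ^ (c₁ + 1) := (pow_succ D c₁).symm
  have hLD : 2 * L + 3 + c ≤ D ^ 2 := by
    calc 2 * L + 3 + c ≤ D + D := by omega
      _ ≤ D * D := add_le_mul hD2 hD2
      _ = D ^ 2 := (sq D).symm
  have hP1 : 2 ≤ D ^ (c₁ + 1) := le_trans hD2 (Nat.le_self_pow (by omega) D)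
  have hP2 : 2 ≤ D ^ 2 := le_trans hD2 (Nat.le_self_pow (by omega) D)
  have hbase : Nat.log 2 (d + k) + c ≤ D ^ (c₁ + 3) := by
    calc Nat.log 2 (d + k) + c ≤ A + (2 * L + 3 + c) := by omega
      _ ≤ D ^ (c₁ + 1) + D ^ 2 := Nat.add_le_add hAD hLD
      _ ≤ D ^ (c₁ + 1) * D ^ 2 := add_le_mul hP1 hP2
      _ = D ^ (c₁ + 3) := by rw [← pow_add]
  have hDK : D ≤ L + (c₁ + c + 3 + (c₁ + 3) * c) := by omega
  calc (Nat.log 2 (d + k) + c) ^ c ≤ (D ^ (c₁ + 3)) ^ c := Nat.pow_le_pow_left hbase c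
    _ = D ^ ((c₁ + 3) * c) := by rw [← pow_mul]
    _ ≤ (L + (c₁ + c + 3 + (c₁ + 3) * c)) ^ ((c₁ + 3) * c) := Nat.pow_le_pow_left hDK _
    _ ≤ (L + (c₁ + c + 3 + (c₁ + 3) * c)) ^ (c₁ + c + 3 + (c₁ + 3) * c) :=
        Nat.pow_le_pow_right (by omega) (by omega)

/-- **Assembly** (route PolyaContinued, item `stmt-ValiantsHypothesis-7427`):
`PfaffianCoverHard → PfaffianNormalForm → ValiantsHypothesis` (`VP ℂ ≠ VNP ℂ`). Bookkeeping over
proved cone facts: were the permanent a `VP` family, `dc(per_n) ≤ 2^((log₂ n + c₁)^c₁)`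
(`isQPBounded_determinantalComplexity_of_isVPFamily_holds`) would be attained
(`hasDetRepr_determinantalComplexity_holds`) and `PfaffianNormalForm` would give a Pfaffian cover
of `per_n` of size `≤ 2^((log₂ n + K)^K)`, `K = c₁ + c + 3 + (c₁ + 3)c`, contradicting
`PfaffianCoverHard`; the hub lemma `Hub.valiantsHypothesis_of_not_isVPFamily_per` with the bridge
`mem_VP_ofFintype_iff_holds` and `perFamily_mem_VNP_holds` converts "per is not a `VP` family"
into `VP ℂ ≠ VNP ℂ`. [folklore] -/
theorem assembly_proof :
    Summit.ValiantsHypothesis.ValiantsHypothesis.Theses.PolyaContinued.Assembly := by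
  unfold Summit.ValiantsHypothesis.ValiantsHypothesis.Theses.PolyaContinued.Assembly
  intro hCover hNF
  refine Summit.ValiantsHypothesis.Hub.valiantsHypothesis_of_not_isVPFamily_per ?_
    (mem_VP_ofFintype_iff_holds _) (perFamily_mem_VNP_holds ℂ)
  intro hfam
  obtain ⟨c₁, hc₁⟩ :=
    isQPBounded_determinantalComplexity_of_isVPFamily_holds (fun n => perPoly (Fin n) ℂ) hfam
  obtain ⟨c, hc⟩ := hNF
  apply hCover
  refine ⟨c₁ + c + 3 + (c₁ + 3) * c, fun n => ?_⟩
  obtain ⟨m', hm', E, P, hP, hs, hproj⟩ :=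
    hc (perPoly (Fin n) ℂ) _ (hasDetRepr_determinantalComplexity_holds _)
  refine ⟨m', le_trans hm' (Nat.pow_le_pow_right Nat.two_pos ?_), E, P, hP, hs, hproj⟩
  have hn : n < 2 ^ (Nat.log 2 n + 1) := Nat.lt_pow_succ_log_self Nat.one_lt_two n
  refine assembly_exponent_le (Nat.log 2 n) c₁ c _ _ (hc₁ n) ?_
  rw [Fintype.card_prod, Fintype.card_fin]
  calc n * n ≤ 2 ^ (Nat.log 2 n + 1) * 2 ^ (Nat.log 2 n + 1) := Nat.mul_le_mul hn.le hn.le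
    _ = 2 ^ (2 * Nat.log 2 n + 2) := by rw [← pow_add]; ring_nf

end Summit.ValiantsHypothesis.ValiantsHypothesis.Theorems.PolyaContinued
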